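import Summits.QuantumFields.YangMills.Theorems.ColdStartUniversalityLatticeLangevinPlaquetteCarre
import HarnessLib

/-!
# Route `ColdStartUniversality` (fixed-cut-off package, Bakry–Émery side): the CARRÉ DU CHAMP OF THE LINK FIELD `⟨Q_e, E⟩` averaged over
# the links — `Γ(c·Σ_e Re tr(Q_e Eᴴ)) ≤ 2c²·‖E‖²·#E` on `SU(2)^E`, `E` = edges of `(ℤ/L)³` (the input of SZZ's link-susceptibility corollary)

Helper file (seat `ym-line-csu-p1`, g27; `--supports stmt-QuantumFields-24809`).  Companion of `…PlaquetteCarre` for the second family of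
observables in Shen–Zhu–Zhu's applications of the Poincaré inequality (CMP 400 (2023) §4, Cor. 4.7: the link field `⟨Q_e, E⟩ = Re tr(Q_e Eᴴ)`,
`E ∈ M_N(ℂ)`):
* `abs_re_trace_mul_mul_conjTranspose_le` — `|Re tr(A Q Eᴴ)| ≤ (u‖E‖² + ‖A‖²/u)/2` for unitary `Q`, every `u > 0`;
* `linkField_frameDeriv_eq` — along the noise frame, the derivative of a function reading `c·Σ_e Re tr(M_e Eᴴ)` through the coordinates is
  `c·Σ_e Re tr(A_e Q_e Eᴴ)` (curve `e^(tA)Q`);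
* ★★ `wilson_linkField_carreBound` — `Σ_n (DΛ_(c,E)(y)[σ_n y])² ≤ 2c²·‖E‖²·#E` at every configuration (duality as in `wilson_carreBound`,
  `u = 2|c|`);
* ★★ `wilson_linkField_carre_le` — the same in the coordinate carré-du-champ currency (hypothesis shape of `wilson_concentration_uniform` /
  `wilson_variance_le_of_carre_uniform`); with `c = 1/#E`, `‖E‖ = 1`: `Γ ≤ 2/#E`.
[cite: ShenZhuZhu2022, §4 Corollary 4.7 (proof: |∇f|² ≤ γ)]  THEOREMS ONLY, no definition, no sorry.  HONEST FRAMING: fixed-cut-off plumbing for a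
RECORD rung; nothing K-uniform; no crux, rung or summit statement is proved; the Yang–Mills mass gap is NOT proved.
-/

set_option autoImplicit false

noncomputable section

namespace Summit.QuantumFields.YangMills.Theorems.ColdStartUniversality

open MeasureTheory Matrix Complex Finset
open scoped ComplexConjugate BigOperators Matrix
open Literature.MathematicalPhysics.QuantumFieldTheory
open Literature.MathematicalPhysics.QuantumLattice (fundamentalRep fundamentalLatticeRep continuous_fundamentalRep fundamentalRep_apply)
open Summit.Ventures.YMGap.HessianSharp (perturb tangentNormSq frobSq re_trace_mul_mul_le frobSq_neg frobSq_nonneg frobSq_conjTranspose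
  mul_conjTranspose_self_of_mem hasDerivAt_reTrace)

/-! ## §1. A trace bound -/

section General

variable {n : Type*} [Fintype n] [DecidableEq n]

/-- `|Re tr(A Q Eᴴ)| ≤ (u‖E‖² + ‖A‖²/u)/2` for unitary `Q` and every `u > 0` (`Re tr(A Q Eᴴ) = Re tr((√u Eᴴ)(A/√u) Q)` and the
venture's square). [folklore] -/
theorem abs_re_trace_mul_mul_conjTranspose_le (A Q E : Matrix n n ℂ) (hQ : Q * Qᴴ = 1) {u : ℝ} (hu : 0 < u) :
    |(A * Q * Eᴴ).trace.re| ≤ (u * frobSq E + frobSq A / u) / 2 := by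
  have key : ∀ B : Matrix n n ℂ, (B * Q * Eᴴ).trace.re ≤ (u * frobSq E + frobSq B / u) / 2 := by
    intro B
    set s : ℝ := Real.sqrt u with hs
    have hs0 : 0 < s := Real.sqrt_pos.2 hu
    have hss : s * s = u := Real.mul_self_sqrt hu.le
    have hsne : (s : ℂ) ≠ 0 := by exact_mod_cast hs0.ne'
    have hcyc : (B * Q * Eᴴ).trace = (Eᴴ * B * Q).trace := by
      rw [Matrix.trace_mul_comm, ← Matrix.mul_assoc]
    have hprod : ((s : ℂ) • Eᴴ) * (((s⁻¹ : ℝ) : ℂ) • B) * Q = Eᴴ * B * Q := by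
      rw [Matrix.smul_mul, Matrix.mul_smul, smul_smul, Complex.ofReal_inv, mul_inv_cancel₀ hsne, one_smul]
    have h := re_trace_mul_mul_le ((s : ℂ) • Eᴴ) (((s⁻¹ : ℝ) : ℂ) • B) Q hQ
    rw [hprod, frobSq_real_smul, frobSq_real_smul, frobSq_conjTranspose, ← hcyc] at h
    have e1 : s ^ 2 = u := by rw [sq, hss]
    have e2 : s⁻¹ ^ 2 * frobSq B = frobSq B / u := by rw [inv_pow, e1]; ring
    rw [e1, e2] at h
    exact h
  rw [abs_le]
  refine ⟨?_, key A⟩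
  have h := key (-A)
  rw [Matrix.neg_mul, Matrix.neg_mul, Matrix.trace_neg, Complex.neg_re, frobSq_neg] at h
  linarith

end General

variable {L : ℕ} [NeZero L]

/-! ## §2. The frame derivative of the link field -/

section Curve

set_option backward.isDefEq.respectTransparency false

open scoped Matrix.Norms.Operator

/-- **First derivative of the link field along the exponential curve.**  For configurations `Q, A`, a matrix `E`, a `C¹` function `φ`
of the real coordinates with `φ(flat M) = c·Σ_e Re tr(M_e Eᴴ)` and a linear field `S` with `S z = flat(A · rebuild z)`:
`Dφ(flat Q)[S(flat Q)] = c·Σ_e Re tr(A_e Q_e Eᴴ)`. [folklore] -/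
theorem linkField_frameDeriv_eq (Q A : (Edge 3 L → Matrix (Fin (fundamentalLatticeRep 2).N) (Fin (fundamentalLatticeRep 2).N) ℂ)) (E : Matrix (Fin (fundamentalLatticeRep 2).N) (Fin (fundamentalLatticeRep 2).N) ℂ) (c : ℝ)
    (φ : (Edge 3 L × Fin (fundamentalLatticeRep 2).N × Fin (fundamentalLatticeRep 2).N × Bool → ℝ) → ℝ) (hφ : ContDiff ℝ 1 φ)
    (hφW : ∀ M : (Edge 3 L → Matrix (Fin (fundamentalLatticeRep 2).N) (Fin (fundamentalLatticeRep 2).N) ℂ), φ (fun q : Edge 3 L × Fin (fundamentalLatticeRep 2).N × Fin (fundamentalLatticeRep 2).N × Bool => (fun z : ℂ => if q.2.2.2 then z.im else z.re) (M q.1 q.2.1 q.2.2.1)) = c * ∑ e : Edge 3 L, (M e * Eᴴ).trace.re)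
    (S : (Edge 3 L × Fin (fundamentalLatticeRep 2).N × Fin (fundamentalLatticeRep 2).N × Bool → ℝ) →L[ℝ] (Edge 3 L × Fin (fundamentalLatticeRep 2).N × Fin (fundamentalLatticeRep 2).N × Bool → ℝ))
    (hS : ∀ z : (Edge 3 L × Fin (fundamentalLatticeRep 2).N × Fin (fundamentalLatticeRep 2).N × Bool → ℝ), S z = (fun q : Edge 3 L × Fin (fundamentalLatticeRep 2).N × Fin (fundamentalLatticeRep 2).N × Bool => (fun z : ℂ => if q.2.2.2 then z.im else z.re) ((fun (e : Edge 3 L) => A e * (fun (ee : Edge 3 L) => Matrix.of fun (i j : Fin (fundamentalLatticeRep 2).N) => ((z (ee, i, j, false) : ℝ) : ℂ) + ((z (ee, i, j, true) : ℝ) : ℂ) * Complex.I) e) q.1 q.2.1 q.2.2.1))) :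
    fderiv ℝ φ (fun q : Edge 3 L × Fin (fundamentalLatticeRep 2).N × Fin (fundamentalLatticeRep 2).N × Bool => (fun z : ℂ => if q.2.2.2 then z.im else z.re) (Q q.1 q.2.1 q.2.2.1)) (S (fun q : Edge 3 L × Fin (fundamentalLatticeRep 2).N × Fin (fundamentalLatticeRep 2).N × Bool => (fun z : ℂ => if q.2.2.2 then z.im else z.re) (Q q.1 q.2.1 q.2.2.1))) = c * ∑ e : Edge 3 L, (A e * Q e * Eᴴ).trace.re := by
  classical
  set reb : (Edge 3 L × Fin (fundamentalLatticeRep 2).N × Fin (fundamentalLatticeRep 2).N × Bool → ℝ) → (Edge 3 L → Matrix (Fin (fundamentalLatticeRep 2).N) (Fin (fundamentalLatticeRep 2).N) ℂ) := fun z => (fun (ee : Edge 3 L) => Matrix.of fun (i j : Fin (fundamentalLatticeRep 2).N) => ((z (ee, i, j, false) : ℝ) : ℂ) + ((z (ee, i, j, true) : ℝ) : ℂ) * Complex.I) with hreb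
  set flat : (Edge 3 L → Matrix (Fin (fundamentalLatticeRep 2).N) (Fin (fundamentalLatticeRep 2).N) ℂ) → (Edge 3 L × Fin (fundamentalLatticeRep 2).N × Fin (fundamentalLatticeRep 2).N × Bool → ℝ) := fun M => (fun q : Edge 3 L × Fin (fundamentalLatticeRep 2).N × Fin (fundamentalLatticeRep 2).N × Bool => (fun z : ℂ => if q.2.2.2 then z.im else z.re) (M q.1 q.2.1 q.2.2.1)) with hflat
  have r_flat : ∀ M : (Edge 3 L → Matrix (Fin (fundamentalLatticeRep 2).N) (Fin (fundamentalLatticeRep 2).N) ℂ), reb (flat M) = M := fun M => rebuild_flat_of M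
  have hS' : ∀ z : (Edge 3 L × Fin (fundamentalLatticeRep 2).N × Fin (fundamentalLatticeRep 2).N × Bool → ℝ), S z = flat (fun e => A e * reb z e) := fun z => hS z
  have hφW' : ∀ M : (Edge 3 L → Matrix (Fin (fundamentalLatticeRep 2).N) (Fin (fundamentalLatticeRep 2).N) ℂ), φ (flat M) = c * ∑ e : Edge 3 L, (M e * Eᴴ).trace.re := fun M => hφW M
  -- `flat` as a continuous linear map
  have fl_add : ∀ M M' : (Edge 3 L → Matrix (Fin (fundamentalLatticeRep 2).N) (Fin (fundamentalLatticeRep 2).N) ℂ), flat (M + M') = flat M + flat M' := by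
    intro M M'; funext q; obtain ⟨e, i, j, b⟩ := q
    cases b
    · show ((M + M') e i j).re = (M e i j).re + (M' e i j).re
      rfl
    · show ((M + M') e i j).im = (M e i j).im + (M' e i j).im
      rfl
  have fl_smul : ∀ (a : ℝ) (M : (Edge 3 L → Matrix (Fin (fundamentalLatticeRep 2).N) (Fin (fundamentalLatticeRep 2).N) ℂ)), flat (a • M) = a • flat M := by
    intro a M; funext q; obtain ⟨e, i, j, b⟩ := q
    cases b
    · show (a • M e i j).re = a * (M e i j).re
      rw [Complex.smul_re, smul_eq_mul]
    · show (a • M e i j).im = a * (M e i j).im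
      rw [Complex.smul_im, smul_eq_mul]
  let Fl : (Edge 3 L → Matrix (Fin (fundamentalLatticeRep 2).N) (Fin (fundamentalLatticeRep 2).N) ℂ) →ₗ[ℝ] (Edge 3 L × Fin (fundamentalLatticeRep 2).N × Fin (fundamentalLatticeRep 2).N × Bool → ℝ) := { toFun := flat, map_add' := fl_add, map_smul' := fl_smul }
  let Fc : (Edge 3 L → Matrix (Fin (fundamentalLatticeRep 2).N) (Fin (fundamentalLatticeRep 2).N) ℂ) →L[ℝ] (Edge 3 L × Fin (fundamentalLatticeRep 2).N × Fin (fundamentalLatticeRep 2).N × Bool → ℝ) := LinearMap.toContinuousLinearMap Fl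
  have hFc : ∀ M, Fc M = flat M := fun M => rfl
  -- the curve `t ↦ e^(tA) Q` and its derivative
  set cM : ℝ → (Edge 3 L → Matrix (Fin (fundamentalLatticeRep 2).N) (Fin (fundamentalLatticeRep 2).N) ℂ) := fun t => perturb Q A t with hcM
  have hcM_d : ∀ t, HasDerivAt cM (fun e => A e * NormedSpace.exp (t • A e) * Q e) t := by
    intro t
    refine hasDerivAt_pi.2 fun e => ?_
    exact (hasDerivAt_exp_smul_const' (𝕂 := ℝ) (A e) t).mul_const (Q e)
  have hdir : ∀ t, Fc (fun e => A e * NormedSpace.exp (t • A e) * Q e) = S (flat (cM t)) := by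
    intro t
    rw [hFc, hS']
    have hin : (fun e => A e * NormedSpace.exp (t • A e) * Q e) = fun e => A e * reb (flat (cM t)) e :=
      funext fun e => by rw [r_flat, Matrix.mul_assoc]; rfl
    exact congrArg flat hin
  have hcd : ∀ t, HasDerivAt (fun t => flat (cM t)) (S (flat (cM t))) t := fun t =>
    (Fc.hasFDerivAt.comp_hasDerivAt t (hcM_d t)).congr_deriv (hdir t)
  have hc0 : flat (cM 0) = flat Q := by
    have h0 : cM 0 = Q := funext fun e => by
      simp only [hcM, perturb, zero_smul, NormedSpace.exp_zero, Matrix.one_mul]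
    rw [h0]
  -- first derivative of `φ ∘ c` two ways
  have hφd : Differentiable ℝ φ := hφ.differentiable one_ne_zero
  have hd1 : HasDerivAt (fun t => φ (flat (cM t))) (fderiv ℝ φ (flat (cM 0)) (S (flat (cM 0)))) 0 :=
    (hφd (flat (cM 0))).hasFDerivAt.comp_hasDerivAt 0 (hcd 0)
  have hW1 : HasDerivAt (fun t => φ (flat (cM t))) (c * ∑ e : Edge 3 L, (A e * Q e * Eᴴ).trace.re) 0 := by
    have hfun : (fun t => φ (flat (cM t))) = fun t => c * ∑ e : Edge 3 L, (NormedSpace.exp (t • A e) * (Q e * Eᴴ)).trace.re := by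
      funext t
      rw [hφW' (cM t)]
      congr 1
      refine Finset.sum_congr rfl fun e _ => ?_
      simp only [hcM, perturb, Matrix.mul_assoc]
    rw [hfun]
    have hterm : ∀ e : Edge 3 L, HasDerivAt (fun t : ℝ => (NormedSpace.exp (t • A e) * (Q e * Eᴴ)).trace.re)
        ((A e * NormedSpace.exp ((0 : ℝ) • A e) * (Q e * Eᴴ)).trace.re) 0 := fun e =>
      hasDerivAt_reTrace ((hasDerivAt_exp_smul_const' (𝕂 := ℝ) (A e) 0).mul_const (Q e * Eᴴ))
    have hsum := (HasDerivAt.fun_sum fun e (_ : e ∈ (Finset.univ : Finset (Edge 3 L))) => hterm e).const_mul c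
    refine hsum.congr_deriv ?_
    congr 1
    refine Finset.sum_congr rfl fun e _ => ?_
    simp only [zero_smul, NormedSpace.exp_zero, Matrix.mul_one, Matrix.mul_assoc]
  have hkey := hd1.unique hW1
  rw [hc0] at hkey
  exact hkey

end Curve

/-! ## §3. The carré du champ of the link field along the noise frame -/

/-- ★★ **`Γ(Λ_(c,E)) ≤ 2c²‖E‖²·#E` pointwise** for the link field `Λ_(c,E)(y) = c·Σ_e Re tr((rebuild y)_e Eᴴ)`: at every configuration `V`,
`Σ_n (DΛ_(c,E)(y)[σ_n y])² ≤ 2 c² ‖E‖²_HS #E` (`y = coords V`; duality with `A_e = √2Σ_ν a_(e,ν)𝐩E_ν`, `Σ‖A_e‖² ≤ 2Σa²`,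
`|Σ_e Re tr(A_eQ_eEᴴ)| ≤ (u‖E‖²#E + Σ‖A_e‖²/u)/2`, `u = 2|c|`). [cite: ShenZhuZhu2022, §4 Corollary 4.7] -/
theorem wilson_linkField_carreBound (L : ℕ) [NeZero L] (E : Matrix (Fin (fundamentalLatticeRep 2).N) (Fin (fundamentalLatticeRep 2).N) ℂ) (c : ℝ) (V : (GaugeConfig 3 L (Matrix.specialUnitaryGroup (Fin 2) ℂ))) :
    ∑ n : Edge 3 L × NoiseIdx (fundamentalLatticeRep 2).N, (fderiv ℝ (fun y : (Edge 3 L × Fin (fundamentalLatticeRep 2).N × Fin (fundamentalLatticeRep 2).N × Bool → ℝ) => c * ∑ e : Edge 3 L, (((fun (ee : Edge 3 L) => Matrix.of fun (i j : Fin (fundamentalLatticeRep 2).N) => ((y (ee, i, j, false) : ℝ) : ℂ) + ((y (ee, i, j, true) : ℝ) : ℂ) * Complex.I) e) * Eᴴ).trace.re) ((fun (V : GaugeConfig 3 L (Matrix.specialUnitaryGroup (Fin 2) ℂ)) (q : Edge 3 L × Fin (fundamentalLatticeRep 2).N × Fin (fundamentalLatticeRep 2).N × Bool) => (fun z : ℂ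 => if q.2.2.2 then z.im else z.re) ((fundamentalRep (Fin 2) (V q.1) : Matrix (Fin 2) (Fin 2) ℂ) q.2.1 q.2.2.1)) V) (fun q : Edge 3 L × Fin (fundamentalLatticeRep 2).N × Fin (fundamentalLatticeRep 2).N × Bool => if n.1 = q.1 then (fun z : ℂ => if q.2.2.2 then z.im else z.re) (((Real.sqrt 2 : ℂ) • ((fundamentalLatticeRep 2).lieProj (noiseDir n.2) * (fun (ee : Edge 3 L) => Matrix.of fun (i j : Fin (fundamentalLatticeRep 2).N) => (((fun (V : GaugeConfig 3 L (Matrix.specialUnitaryGroup (Fin 2) ℂ)) (q : Edge 3 L × Fin (fundamentalLatticeRep 2).N × Fin (fundamentalLatticeRep 2).N × Bool) => (fun z : ℂ => if q.2.2.2 then z.im else z.re) ((fundamentalRep (Fin 2) (V q.1) : Matrix (Fin 2) (Fin 2) ℂ) q.2.1 q.2.2.1)) V (ee, i, j, false) : ℝ) : ℂ) + (((fun (V : GaugeConfig 3 L (Matrix.specialUnitaryGroup (Fin 2) ℂ)) (q : Edge 3 L × Fin (fundamentalLatticeRep 2).N × Fin (fundamentalLatticeRep 2).N × Bool) => (fun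 z : ℂ => if q.2.2.2 then z.im else z.re) ((fundamentalRep (Fin 2) (V q.1) : Matrix (Fin 2) (Fin 2) ℂ) q.2.1 q.2.2.1)) V (ee, i, j, true) : ℝ) : ℂ) * Complex.I) q.1)) q.2.1 q.2.2.1) else 0)) ^ 2
      ≤ 2 * c ^ 2 * frobSq E * Fintype.card (Edge 3 L) := by
  classical
  obtain ⟨s, cst, hs, -, -, -, -⟩ := exists_noiseFrame L
  -- abbreviations
  set P : NoiseIdx (fundamentalLatticeRep 2).N → Matrix (Fin (fundamentalLatticeRep 2).N) (Fin (fundamentalLatticeRep 2).N) ℂ := fun ν => (fundamentalLatticeRep 2).lieProj (noiseDir ν) with hP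
  set reb : (Edge 3 L × Fin (fundamentalLatticeRep 2).N × Fin (fundamentalLatticeRep 2).N × Bool → ℝ) → (Edge 3 L → Matrix (Fin (fundamentalLatticeRep 2).N) (Fin (fundamentalLatticeRep 2).N) ℂ) := fun z => (fun (ee : Edge 3 L) => Matrix.of fun (i j : Fin (fundamentalLatticeRep 2).N) => ((z (ee, i, j, false) : ℝ) : ℂ) + ((z (ee, i, j, true) : ℝ) : ℂ) * Complex.I) with hreb
  set flat : (Edge 3 L → Matrix (Fin (fundamentalLatticeRep 2).N) (Fin (fundamentalLatticeRep 2).N) ℂ) → (Edge 3 L × Fin (fundamentalLatticeRep 2).N × Fin (fundamentalLatticeRep 2).N × Bool → ℝ) := fun M => (fun q : Edge 3 L × Fin (fundamentalLatticeRep 2).N × Fin (fundamentalLatticeRep 2).N × Bool => (fun z : ℂ => if q.2.2.2 then z.im else z.re) (M q.1 q.2.1 q.2.2.1)) with hflat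
  set σ : (Edge 3 L × NoiseIdx (fundamentalLatticeRep 2).N) → (Edge 3 L × Fin (fundamentalLatticeRep 2).N × Fin (fundamentalLatticeRep 2).N × Bool → ℝ) → (Edge 3 L × Fin (fundamentalLatticeRep 2).N × Fin (fundamentalLatticeRep 2).N × Bool → ℝ) := fun n z => (fun q : Edge 3 L × Fin (fundamentalLatticeRep 2).N × Fin (fundamentalLatticeRep 2).N × Bool => if n.1 = q.1 then (fun z : ℂ => if q.2.2.2 then z.im else z.re) (((Real.sqrt 2 : ℂ) • ((fundamentalLatticeRep 2).lieProj (noiseDir n.2) * (fun (ee : Edge 3 L) => Matrix.of fun (i j : Fin (fundamentalLatticeRep 2).N) => ((z (ee, i, j, false) : ℝ) : ℂ) + ((z (ee, i, j, true) : ℝ) : ℂ) * Complex.I) q.1)) q.2.1 q.2.2.1) else 0) with hσ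
  set ψ : (Edge 3 L × Fin (fundamentalLatticeRep 2).N × Fin (fundamentalLatticeRep 2).N × Bool → ℝ) → ℝ := (fun y : (Edge 3 L × Fin (fundamentalLatticeRep 2).N × Fin (fundamentalLatticeRep 2).N × Bool → ℝ) => c * ∑ e : Edge 3 L, (((fun (ee : Edge 3 L) => Matrix.of fun (i j : Fin (fundamentalLatticeRep 2).N) => ((y (ee, i, j, false) : ℝ) : ℂ) + ((y (ee, i, j, true) : ℝ) : ℂ) * Complex.I) e) * Eᴴ).trace.re) with hψ
  set y : (Edge 3 L × Fin (fundamentalLatticeRep 2).N × Fin (fundamentalLatticeRep 2).N × Bool → ℝ) := (fun (V : GaugeConfig 3 L (Matrix.specialUnitaryGroup (Fin 2) ℂ)) (q : Edge 3 L × Fin (fundamentalLatticeRep 2).N × Fin (fundamentalLatticeRep 2).N × Bool) => (fun z : ℂ => if q.2.2.2 then z.im else z.re) ((fundamentalRep (Fin 2) (V q.1) : Matrix (Fin 2) (Fin 2) ℂ) q.2.1 q.2.2.1)) V with hy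
  have hsσ : ∀ n z, s n z = σ n z := fun n z => hs n z
  -- `rebuild` facts
  have r_smul : ∀ (a : ℝ) (v : (Edge 3 L × Fin (fundamentalLatticeRep 2).N × Fin (fundamentalLatticeRep 2).N × Bool → ℝ)), reb (a • v) = (a : ℂ) • reb v := fun a v => rebuild_smul a v
  have r_sum : ∀ f : (Edge 3 L × NoiseIdx (fundamentalLatticeRep 2).N) → (Edge 3 L × Fin (fundamentalLatticeRep 2).N × Fin (fundamentalLatticeRep 2).N × Bool → ℝ), reb (∑ k, f k) = ∑ k, reb (f k) :=
    fun f => rebuild_sum Finset.univ f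
  have r_inj : ∀ v w : (Edge 3 L × Fin (fundamentalLatticeRep 2).N × Fin (fundamentalLatticeRep 2).N × Bool → ℝ), reb v = reb w → v = w := fun v w h => eq_of_rebuild_eq h
  have r_flat : ∀ M : (Edge 3 L → Matrix (Fin (fundamentalLatticeRep 2).N) (Fin (fundamentalLatticeRep 2).N) ℂ), reb (flat M) = M := fun M => rebuild_flat_of M
  have r_σ : ∀ n z, reb (σ n z) = fun e => if n.1 = e then (Real.sqrt 2 : ℂ) • (P n.2 * reb z e) else 0 :=
    fun n z => rebuild_noise n z
  have flat_reb : ∀ v : (Edge 3 L × Fin (fundamentalLatticeRep 2).N × Fin (fundamentalLatticeRep 2).N × Bool → ℝ), flat (reb v) = v := fun v => r_inj _ _ (r_flat _)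
  -- the coefficients and the combined field
  set x : Edge 3 L × NoiseIdx (fundamentalLatticeRep 2).N → ℝ := fun n => fderiv ℝ ψ y (s n y) with hx
  set S : (Edge 3 L × Fin (fundamentalLatticeRep 2).N × Fin (fundamentalLatticeRep 2).N × Bool → ℝ) →L[ℝ] (Edge 3 L × Fin (fundamentalLatticeRep 2).N × Fin (fundamentalLatticeRep 2).N × Bool → ℝ) := ∑ n, x n • s n with hSdef
  have hS_apply : ∀ z, S z = ∑ n, x n • s n z := fun z => by
    rw [hSdef, _root_.sum_apply]
    simp only [FunLike.coe_smul, Pi.smul_apply]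
  set Z : (Edge 3 L → Matrix (Fin (fundamentalLatticeRep 2).N) (Fin (fundamentalLatticeRep 2).N) ℂ) := fun e => ∑ ν, x (e, ν) • P ν with hZ
  set A : (Edge 3 L → Matrix (Fin (fundamentalLatticeRep 2).N) (Fin (fundamentalLatticeRep 2).N) ℂ) := fun e => (Real.sqrt 2 : ℂ) • Z e with hA
  set Q : (Edge 3 L → Matrix (Fin (fundamentalLatticeRep 2).N) (Fin (fundamentalLatticeRep 2).N) ℂ) := fun e => Matrix.of fun i j : Fin (fundamentalLatticeRep 2).N =>
    (fundamentalRep (Fin 2) (V e) : Matrix (Fin 2) (Fin 2) ℂ) i j with hQ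
  have hrebY : reb y = Q := rebuild_coords_of V
  have hyQ : flat Q = y := by rw [← hrebY, flat_reb]
  have hQU : ∀ e, Q e ∈ Matrix.unitaryGroup (Fin (fundamentalLatticeRep 2).N) ℂ := fun e =>
    Matrix.specialUnitaryGroup_le_unitaryGroup (V e).2
  have cx : ∀ (a : ℝ) (W : Matrix (Fin (fundamentalLatticeRep 2).N) (Fin (fundamentalLatticeRep 2).N) ℂ), a • W = (a : ℂ) • W := fun a W => by
    ext i j
    simp only [Matrix.smul_apply, Complex.real_smul, smul_eq_mul]
  -- (F1) `rebuild (S z) = (A_e · rebuild(z)_e)_e`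
  have hrebS : ∀ z, reb (S z) = fun e => A e * reb z e := by
    intro z
    rw [hS_apply, r_sum]
    simp_rw [r_smul, hsσ, r_σ]
    funext e
    rw [Finset.sum_apply]
    have hsplit : ∑ n : Edge 3 L × NoiseIdx (fundamentalLatticeRep 2).N,
        ((x n : ℂ) • (fun e' : Edge 3 L => if n.1 = e' then (Real.sqrt 2 : ℂ) • (P n.2 * reb z e') else (0 : Matrix (Fin (fundamentalLatticeRep 2).N) (Fin (fundamentalLatticeRep 2).N) ℂ))) e
        = ∑ e' : Edge 3 L, ∑ ν : NoiseIdx (fundamentalLatticeRep 2).N,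
          ((x (e', ν) : ℂ) • (fun e'' : Edge 3 L => if (e', ν).1 = e'' then (Real.sqrt 2 : ℂ) • (P (e', ν).2 * reb z e'') else (0 : Matrix (Fin (fundamentalLatticeRep 2).N) (Fin (fundamentalLatticeRep 2).N) ℂ))) e :=
      Fintype.sum_prod_type _
    rw [hsplit, Finset.sum_eq_single e (fun e' _ hne => Finset.sum_eq_zero fun ν _ => by
      simp only [Pi.smul_apply, if_neg hne, smul_zero]) (fun h => absurd (Finset.mem_univ e) h)]
    simp only [Pi.smul_apply, if_true, hA, hZ, Finset.smul_sum, Finset.sum_mul, Matrix.smul_mul]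
    refine Finset.sum_congr rfl fun ν _ => ?_
    rw [cx, smul_comm]
  have hSflat : ∀ z, S z = flat (fun e => A e * reb z e) := fun z =>
    r_inj _ _ ((hrebS z).trans (r_flat _).symm)
  -- `Λ(flat M) = c · Σ_e Re tr(M_e Eᴴ)` and smoothness
  have hψW : ∀ M : (Edge 3 L → Matrix (Fin (fundamentalLatticeRep 2).N) (Fin (fundamentalLatticeRep 2).N) ℂ), ψ (flat M) = c * ∑ e : Edge 3 L, (M e * Eᴴ).trace.re := by
    intro M
    have h1 : ψ (flat M) = c * ∑ e : Edge 3 L, (reb (flat M) e * Eᴴ).trace.re := rfl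
    rw [h1, r_flat]
  have hψC : ContDiff ℝ 1 ψ := by
    refine contDiff_const.mul (ContDiff.sum fun e _ => ?_)
    have hR : ∀ (a b : Fin (fundamentalLatticeRep 2).N), ContDiff ℝ 1 fun z : (Edge 3 L × Fin (fundamentalLatticeRep 2).N × Fin (fundamentalLatticeRep 2).N × Bool → ℝ) => reb z e a b := fun a b => contDiff_entry_rebuild e a b
    exact contDiff_re_trace (contDiff_entry_mul hR (fun a b => contDiff_const))
  -- (F2) first-order identity
  have hkey : fderiv ℝ ψ y (S y) = c * ∑ e : Edge 3 L, (A e * Q e * Eᴴ).trace.re := by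
    have h : fderiv ℝ ψ (flat Q) (S (flat Q)) = c * ∑ e : Edge 3 L, (A e * Q e * Eᴴ).trace.re :=
      linkField_frameDeriv_eq Q A E c ψ hψC hψW S hSflat
    rw [hyQ] at h
    exact h
  -- (F3) duality
  have hexp : fderiv ℝ ψ y (S y) = ∑ n, x n ^ 2 := by
    rw [hS_apply, map_sum]
    refine Finset.sum_congr rfl fun n _ => ?_
    rw [map_smul, smul_eq_mul, sq]
  -- (F4) `Σ_e ‖A_e‖² ≤ 2 Σ x²`
  have hT : tangentNormSq A ≤ 2 * ∑ n, x n ^ 2 := by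
    have hTe : tangentNormSq A = ∑ e, hsForm (fundamentalLatticeRep 2).N (A e) (A e) := rfl
    have hAe : ∀ e, hsForm (fundamentalLatticeRep 2).N (A e) (A e) = 2 * hsForm (fundamentalLatticeRep 2).N (Z e) (Z e) := fun e => by
      show hsForm (fundamentalLatticeRep 2).N ((Real.sqrt 2 : ℂ) • Z e) ((Real.sqrt 2 : ℂ) • Z e) = _
      rw [hsForm_coe_smul_left, hsForm_coe_smul_right, ← mul_assoc, Real.mul_self_sqrt zero_le_two]
    have hZe : ∀ e, hsForm (fundamentalLatticeRep 2).N (Z e) (Z e) ≤ ∑ ν, x (e, ν) ^ 2 := fun e => by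
      have hZp : Z e = (fundamentalLatticeRep 2).lieProj (∑ ν, x (e, ν) • noiseDir ν) := by
        show ∑ ν, x (e, ν) • P ν = _
        rw [map_sum]
        simp only [map_smul, hP]
      rw [hZp, ← hsForm_sum_smul_noiseDir_self]
      exact hsForm_lieProj_self_le (fundamentalLatticeRep 2) _
    have hsum : ∑ e, hsForm (fundamentalLatticeRep 2).N (Z e) (Z e) ≤ ∑ e : Edge 3 L, ∑ ν : NoiseIdx (fundamentalLatticeRep 2).N, x (e, ν) ^ 2 :=
      Finset.sum_le_sum fun e _ => hZe e
    have hprod : ∑ n, x n ^ 2 = ∑ e : Edge 3 L, ∑ ν : NoiseIdx (fundamentalLatticeRep 2).N, x (e, ν) ^ 2 :=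
      Fintype.sum_prod_type (fun n : Edge 3 L × NoiseIdx (fundamentalLatticeRep 2).N => x n ^ 2)
    rw [hTe, hprod, Finset.sum_congr rfl fun e _ => hAe e, ← Finset.mul_sum]
    linarith
  -- (F5) the first-variation bound `|Σ_e Re tr(A_e Q_e Eᴴ)| ≤ (u‖E‖²#E + Σ‖A_e‖²/u)/2`
  have hFV : ∀ u : ℝ, 0 < u → |∑ e : Edge 3 L, (A e * Q e * Eᴴ).trace.re| ≤ (u * frobSq E * Fintype.card (Edge 3 L) + tangentNormSq A / u) / 2 := by
    intro u hu
    calc |∑ e : Edge 3 L, (A e * Q e * Eᴴ).trace.re| ≤ ∑ e : Edge 3 L, |(A e * Q e * Eᴴ).trace.re| := Finset.abs_sum_le_sum_abs _ _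
      _ ≤ ∑ e : Edge 3 L, (u * frobSq E + frobSq (A e) / u) / 2 :=
          Finset.sum_le_sum fun e _ => abs_re_trace_mul_mul_conjTranspose_le _ _ _ (mul_conjTranspose_self_of_mem (hQU e)) hu
      _ = (u * frobSq E * Fintype.card (Edge 3 L) + tangentNormSq A / u) / 2 := by
          rw [← Finset.sum_div, Finset.sum_add_distrib, Finset.sum_const, Finset.card_univ, nsmul_eq_mul, ← Finset.sum_div]
          unfold tangentNormSq
          ring
  -- assembly
  have hxn : 0 ≤ ∑ n, x n ^ 2 := Finset.sum_nonneg fun n _ => sq_nonneg _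
  have hfE : 0 ≤ frobSq E := frobSq_nonneg E
  have main : ∑ n, x n ^ 2 ≤ 2 * c ^ 2 * frobSq E * Fintype.card (Edge 3 L) := by
    by_cases hc : c = 0
    · have h0 : ∑ n, x n ^ 2 = 0 := by rw [← hexp, hkey, hc, zero_mul]
      rw [h0, hc]
      simp
    · have hcpos : 0 < |c| := abs_pos.2 hc
      have hu : 0 < 2 * |c| := by positivity
      have h1 : ∑ n, x n ^ 2 ≤ |c| * |∑ e : Edge 3 L, (A e * Q e * Eᴴ).trace.re| := by
        rw [← hexp, hkey, ← abs_mul]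
        exact le_abs_self _
      have h2 := hFV (2 * |c|) hu
      have h3 : |∑ e : Edge 3 L, (A e * Q e * Eᴴ).trace.re| ≤
          (2 * |c| * frobSq E * Fintype.card (Edge 3 L) + (2 * ∑ n, x n ^ 2) / (2 * |c|)) / 2 := by
        refine h2.trans ?_
        gcongr
      have h4 : ∑ n, x n ^ 2 ≤ |c| * ((2 * |c| * frobSq E * Fintype.card (Edge 3 L) + (2 * ∑ n, x n ^ 2) / (2 * |c|)) / 2) :=
        h1.trans (mul_le_mul_of_nonneg_left h3 hcpos.le)
      have e1 : |c| * ((2 * |c| * frobSq E * Fintype.card (Edge 3 L) + (2 * ∑ n, x n ^ 2) / (2 * |c|)) / 2) =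
          |c| ^ 2 * frobSq E * Fintype.card (Edge 3 L) + (1 / 2) * ∑ n, x n ^ 2 := by
        field_simp
      rw [e1, sq_abs] at h4
      linarith
  have hsV : ∀ k : Edge 3 L × NoiseIdx (fundamentalLatticeRep 2).N, s k y = σ k y := fun k => hs k y
  simp only [hx, hsV] at main
  exact main

/-! ## §4. The coordinate carré-du-champ form -/

/-- ★★ **The carré du champ of the link field is at most `2c²‖E‖²·#E`, uniformly** (coordinate form, hypothesis shape of
`wilson_concentration_uniform` / `wilson_variance_le_of_carre_uniform`; `E : M₂(ℂ)` arbitrary, `‖E‖² = Re tr(EEᴴ)`).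
[cite: ShenZhuZhu2022, §4 Corollary 4.7] -/
theorem wilson_linkField_carre_le (L : ℕ) [NeZero L] (β' : ℝ) (E : Matrix (Fin 2) (Fin 2) ℂ) (c : ℝ) :
    let coords : GaugeConfig 3 L (Matrix.specialUnitaryGroup (Fin 2) ℂ) → (Edge 3 L × Fin 2 × Fin 2 × Bool → ℝ) :=
      fun V q => (fun z : ℂ => if q.2.2.2 then z.im else z.re)
        ((fundamentalRep (Fin 2) (V q.1) : Matrix (Fin 2) (Fin 2) ℂ) q.2.1 q.2.2.1)
    let A : GaugeConfig 3 L (Matrix.specialUnitaryGroup (Fin 2) ℂ) → (Edge 3 L × Fin 2 × Fin 2 × Bool) →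
        (Edge 3 L × Fin 2 × Fin 2 × Bool) → ℝ := fun V i j =>
      ∑ n : Edge 3 L × NoiseIdx 2,
        (if n.1 = i.1 then (fun z : ℂ => if i.2.2.2 then z.im else z.re)
          ((latticeLangevinDynamics (fundamentalLatticeRep 2) β').noise
            (matrixConfig (fundamentalRep (Fin 2)) V) i.1 n.2 i.2.1 i.2.2.1) else 0) *
        (if n.1 = j.1 then (fun z : ℂ => if j.2.2.2 then z.im else z.re)
          ((latticeLangevinDynamics (fundamentalLatticeRep 2) β').noise
            (matrixConfig (fundamentalRep (Fin 2)) V) j.1 n.2 j.2.1 j.2.2.1) else 0)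
    ∀ V : (GaugeConfig 3 L (Matrix.specialUnitaryGroup (Fin 2) ℂ)), (∑ i : Edge 3 L × Fin 2 × Fin 2 × Bool, ∑ j : Edge 3 L × Fin 2 × Fin 2 × Bool,
      fderiv ℝ (fun y : (Edge 3 L × Fin 2 × Fin 2 × Bool → ℝ) => c * ∑ e : Edge 3 L, (((fun (ee : Edge 3 L) => Matrix.of fun (i j : Fin 2) => ((y (ee, i, j, false) : ℝ) : ℂ) + ((y (ee, i, j, true) : ℝ) : ℂ) * Complex.I) e) * Eᴴ).trace.re) (coords V) (Pi.single i 1) * fderiv ℝ (fun y : (Edge 3 L × Fin 2 × Fin 2 × Bool → ℝ) => c * ∑ e : Edge 3 L, (((fun (ee : Edge 3 L) => Matrix.of fun (i j : Fin 2) => ((y (ee, i, j, false) : ℝ) : ℂ) + ((y (ee, i, j, true) : ℝ) : ℂ) * Complex.I) e) * Eᴴ).trace.re) (coords V) (Pi.single j 1) * A V i j)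
        ≤ 2 * c ^ 2 * (E * Eᴴ).trace.re * Fintype.card (Edge 3 L) := by
  intro coords A V
  classical
  set cV : Edge 3 L × Fin 2 × Fin 2 × Bool → ℝ := coords V with hc
  set Q : MatrixConfig 3 L (fundamentalLatticeRep 2).N := matrixConfig (fundamentalRep (Fin 2)) V with hQdef
  set coordOf : (Fin 2 × Fin 2 × Bool) → Matrix (Fin (fundamentalLatticeRep 2).N) (Fin (fundamentalLatticeRep 2).N) ℂ → ℝ := fun p X =>
    (fun z : ℂ => if p.2.2 then z.im else z.re) (X p.1 p.2.1) with hcoordOf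
  set σ : (Edge 3 L × Fin 2 × Fin 2 × Bool) → (Edge 3 L × NoiseIdx 2) → ℝ := fun i n =>
    if n.1 = i.1 then coordOf i.2 ((latticeLangevinDynamics (fundamentalLatticeRep 2) β').noise Q i.1 n.2) else 0 with hσ
  have hA : ∀ i j, A V i j = ∑ n, σ i n * σ j n := fun i j => rfl
  set D : (Edge 3 L × Fin 2 × Fin 2 × Bool → ℝ) →L[ℝ] ℝ := fderiv ℝ (fun y : (Edge 3 L × Fin 2 × Fin 2 × Bool → ℝ) => c * ∑ e : Edge 3 L, (((fun (ee : Edge 3 L) => Matrix.of fun (i j : Fin 2) => ((y (ee, i, j, false) : ℝ) : ℂ) + ((y (ee, i, j, true) : ℝ) : ℂ) * Complex.I) e) * Eᴴ).trace.re) cV with hD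
  have h1 : ∑ i, ∑ j, D (Pi.single i 1) * D (Pi.single j 1) * A V i j = ∑ n, (D (fun i => σ i n)) ^ 2 := by
    simp_rw [hA]
    rw [sum_sum_mul_mul_noiseCov_eq_sum_sq (fun i => D (Pi.single i 1)) σ]
    exact Finset.sum_congr rfl fun n _ => by rw [sum_apply_single_mul_eq_apply]
  rw [h1]
  have hrebQ : ∀ e : Edge 3 L, (Matrix.of fun a b : Fin (fundamentalLatticeRep 2).N => ((cV (e, a, b, false) : ℝ) : ℂ) + ((cV (e, a, b, true) : ℝ) : ℂ) * Complex.I) = Q e :=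
    fun e => (congrFun (rebuild_coords_of V) e).trans (Matrix.ext fun a b => rfl)
  have hvec : ∀ n : Edge 3 L × NoiseIdx 2, (fun i => σ i n) = (fun q : Edge 3 L × Fin (fundamentalLatticeRep 2).N × Fin (fundamentalLatticeRep 2).N × Bool => if n.1 = q.1 then (fun z : ℂ => if q.2.2.2 then z.im else z.re) (((Real.sqrt 2 : ℂ) • ((fundamentalLatticeRep 2).lieProj (noiseDir n.2) * (fun (ee : Edge 3 L) => Matrix.of fun (i j : Fin (fundamentalLatticeRep 2).N) => ((cV (ee, i, j, false) : ℝ) : ℂ) + ((cV (ee, i, j, true) : ℝ) : ℂ) * Complex.I) q.1)) q.2.1 q.2.2.1) else 0) := by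
    intro n
    funext i
    simp only [hσ, hcoordOf]
    by_cases h : n.1 = i.1
    · rw [if_pos h, if_pos h, latticeLangevinDynamics_noise, hrebQ]
    · rw [if_neg h, if_neg h]
  simp_rw [hvec]
  have h6 : ∑ n : Edge 3 L × NoiseIdx 2, (D (fun q : Edge 3 L × Fin (fundamentalLatticeRep 2).N × Fin (fundamentalLatticeRep 2).N × Bool => if n.1 = q.1 then (fun z : ℂ => if q.2.2.2 then z.im else z.re) (((Real.sqrt 2 : ℂ) • ((fundamentalLatticeRep 2).lieProj (noiseDir n.2) * (fun (ee : Edge 3 L) => Matrix.of fun (i j : Fin (fundamentalLatticeRep 2).N) => ((cV (ee, i, j, false) : ℝ) : ℂ) + ((cV (ee, i, j, true) : ℝ) : ℂ) * Complex.I) q.1)) q.2.1 q.2.2.1) else 0)) ^ 2 ≤ 2 * c ^ 2 * frobSq E * Fintype.card (Edge 3 L) :=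
    wilson_linkField_carreBound L E c V
  exact h6

end Summit.QuantumFields.YangMills.Theorems.ColdStartUniversality
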